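import Literature.NumberTheory.Automorphic.UnitaryGroupPureTensorContinuity     -- ★ `toLocal_mem_localIntegralLevel_iff`, `finPart`, `eventually_evalPlace_mem_localInt`, `cmLocalIntegralLevel`
import HarnessLib

/-!
# R90-TF · S10 (Rogawski 1990 §13.8) · THEOREMS — `R90S10ThetaLineEulerBridge`: THE `∏ᶠ`-SPELLED BOX INDICATOR OF THE θ-LINE LETTER,
# `∏ᶠ_{w ≠ v} 1_{K w}(g_w) = 1` ON THE BOX `{∀ w ≠ v, g_w ∈ K w}` AND `= 0` OFF IT

Cell hodgecm-mathlib, slab R90-TF, section S10 = §13.8, crux item h413 = stmt-HodgeConjecture-24833 (route `route-HodgeConjecture-HCCMUnconditional`).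
Prover seat LH7-p07 (g3), ADD-ON to DEAL #58 (S10 dealer R90-C138-plan (g3) «BRIDGE PLEASE = YES», 2026-09-05T03:02Z).  The θ-line letter `hθi` of ★
`S10HDatum` spells its test function as `Φ₁ g₁ z = gi(z_∞) · (g₁(z_v) · ∏ᶠ w : {w // w ≠ v}, 1_{K₁ w}(z_w))`, a `finprod` over the cofinite index type; the
Euler brick `R90S10ThetaLineClassTraceEuler` §3 (`exists_isHaarMeasure_classTrace_mk_ofChar_inv_eq_integral_mul_integral`) takes the BOX form — `hF₁`: on
`{∀ w ≠ v, z_w ∈ K w}` the test function is `gi(z_∞) · g₁(z_v)`, `hF₀`: off it, `0`.  This file is the adapter: the `∏ᶠ` is `1` on the box (every factor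
is `1`) and `0` off it — the latter because the product has FINITE support (almost every component of an adelic point is integral, ★
`eventually_evalPlace_mem_localInt` [the restricted-product condition], read on `U(H)(L⁺_w)` through ★ `toLocal_mem_localIntegralLevel_iff`, and off `v`
the levels are the integral ones) while one factor vanishes (`finprod_eq_zero`); without finite support `∏ᶠ` would be the junk value `1`.

CONTENTS (theorems only; no `def`, no `instance`, no `notation`, no `sorry`; axioms ⊆ {propext, Classical.choice, Quot.sound}; generic `N`, `H`):
* `finprod_indicator_toLocal_eq_one` — `(∀ w ≠ v, g_w ∈ K w) → ∏ᶠ_{w ≠ v} 1_{K w}(g_w) = 1` (any level family `K`).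
* `finprod_indicator_toLocal_eq_zero` — `K w = U(H)(𝒪_w)` for `w ≠ v` and `¬ (∀ w ≠ v, g_w ∈ K w)` `→ ∏ᶠ_{w ≠ v} 1_{K w}(g_w) = 0`.
* `mul_finprod_indicator_toLocal_eq` ∕ `…_eq_zero` — the letter's value `a · (b · ∏ᶠ …)` is `a · b` on the box and `0` off it (the two `hF` cases, ready to `exact`).

HONEST LABEL: bookkeeping; pays no socket; HC_CM is proved only modulo the 7 printed citations (2 remaining named inputs: hLiu418 = stmt-HodgeConjecture-24832,
h413 = stmt-HodgeConjecture-24833) until rung 0 closes; count-neutral helper; REL ≠ ★ ≠ BUILT.  Namespace `Summit.HodgeConjecture.HodgeConjecture.R90.S10`.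

## References
* [BorelJacquet1979] A. Borel, H. Jacquet, *Automorphic forms and automorphic representations*, PSPM 33.1 (1979), §4.1 (restricted tensor products,
  almost all components unramified).
* [Rogawski1990] J. D. Rogawski, *Automorphic Representations of Unitary Groups in Three Variables*, Ann. of Math. Stud. 123 (1990), §13.8 p. 218 L9–10; §14.2 p. 233.
-/

set_option autoImplicit false
-- the mandated namespace repeats the single-problem summit's segment (`HodgeConjecture.HodgeConjecture`)
set_option linter.dupNamespace false

noncomputable section

open NumberField IsDedekindDomain
open Literature.NumberTheory.Automorphic Literature.NumberTheory.Automorphic.UnitaryGroup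

namespace Summit.HodgeConjecture.HodgeConjecture.R90.S10

variable {L : Type} [Field L] [NumberField L] [IsCMField L] {N : ℕ} {H : Matrix (Fin N) (Fin N) L}

/-- **The `∏ᶠ` of level indicators over `w ≠ v` is `1` ON THE BOX** (every factor is `1`). [cite: BorelJacquet1979, §4.1] -/
theorem finprod_indicator_toLocal_eq_one (v : HeightOneSpectrum (𝓞 ↥(maximalRealSubfield L)))
    (K : ∀ w, Subgroup ((cmDatum L N H).Local w)) (g : (cmDatum L N H).Adelic)
    (hg : ∀ w, w ≠ v → (cmDatum L N H).toLocal w g ∈ K w) :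
    ∏ᶠ w : {w : HeightOneSpectrum (𝓞 ↥(maximalRealSubfield L)) // w ≠ v},
      ((K w.1 : Set ((cmDatum L N H).Local w.1))).indicator (fun _ => (1 : ℂ)) ((cmDatum L N H).toLocal w.1 g) = 1 :=
  finprod_eq_one_of_forall_eq_one fun w => Set.indicator_of_mem (hg w.1 w.2) _

/-- **… and `0` OFF THE BOX** when the levels off `v` are the integral ones: almost every component of `g` is integral (★ `eventually_evalPlace_mem_localInt`,
★ `toLocal_mem_localIntegralLevel_iff`), so the `∏ᶠ` has finite support, and one factor vanishes (`finprod_eq_zero`). [cite: BorelJacquet1979, §4.1] -/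
theorem finprod_indicator_toLocal_eq_zero (v : HeightOneSpectrum (𝓞 ↥(maximalRealSubfield L)))
    (K : ∀ w, Subgroup ((cmDatum L N H).Local w)) (hK : ∀ w, w ≠ v → K w = cmLocalIntegralLevel L N H w) (g : (cmDatum L N H).Adelic)
    (hg : ¬ ∀ w, w ≠ v → (cmDatum L N H).toLocal w g ∈ K w) :
    ∏ᶠ w : {w : HeightOneSpectrum (𝓞 ↥(maximalRealSubfield L)) // w ≠ v},
      ((K w.1 : Set ((cmDatum L N H).Local w.1))).indicator (fun _ => (1 : ℂ)) ((cmDatum L N H).toLocal w.1 g) = 0 := by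
  classical
  obtain ⟨w, hw, hgw⟩ : ∃ w, w ≠ v ∧ (cmDatum L N H).toLocal w g ∉ K w := by
    by_contra hcon
    exact hg fun w hw => by_contra fun hgw => hcon ⟨w, hw, hgw⟩
  refine finprod_eq_zero _ ⟨w, hw⟩ (Set.indicator_of_notMem hgw _) ?_
  -- finite support: almost every component is integral, and off `v` the levels are the integral ones
  have hev : ∀ᶠ w in Filter.cofinite, (cmDatum L N H).toLocal w g ∈ cmLocalIntegralLevel L N H w := by
    filter_upwards [eventually_evalPlace_mem_localInt (↥(maximalRealSubfield L)) L (IsCMField.complexConj L) N H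
      (finPart (↥(maximalRealSubfield L)) L (IsCMField.complexConj L) N H g)] with w hw
    exact (toLocal_mem_localIntegralLevel_iff (↥(maximalRealSubfield L)) L (IsCMField.complexConj L) N H w g).2 hw
  refine ((Filter.eventually_cofinite.1 hev).preimage Subtype.val_injective.injOn).subset fun w hw => ?_
  intro hmem
  have hmem' : (cmDatum L N H).toLocal w.1 g ∈ K w.1 := by
    rw [hK w.1 w.2]
    exact hmem
  exact hw (Set.indicator_of_mem hmem' _)

/-- **The letter's value ON the box**: `a · (b · ∏ᶠ_{w ≠ v} 1_{K w}(g_w)) = a · b` when `g_w ∈ K w` for all `w ≠ v` — the `hF₁` case of the Euler brick, for a test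
function given as `F g = gi(g_∞) · (g₁(g_v) · ∏ᶠ …)`. [cite: Rogawski1990, §13.8 p. 218 L9–10] [cite: BorelJacquet1979, §4.1] -/
theorem mul_finprod_indicator_toLocal_eq (v : HeightOneSpectrum (𝓞 ↥(maximalRealSubfield L)))
    (K : ∀ w, Subgroup ((cmDatum L N H).Local w)) (g : (cmDatum L N H).Adelic)
    (hg : ∀ w, w ≠ v → (cmDatum L N H).toLocal w g ∈ K w) (a b : ℂ) :
    a * (b * ∏ᶠ w : {w : HeightOneSpectrum (𝓞 ↥(maximalRealSubfield L)) // w ≠ v},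
      ((K w.1 : Set ((cmDatum L N H).Local w.1))).indicator (fun _ => (1 : ℂ)) ((cmDatum L N H).toLocal w.1 g)) = a * b := by
  rw [finprod_indicator_toLocal_eq_one v K g hg, mul_one]

/-- **The letter's value OFF the box**: `a · (b · ∏ᶠ_{w ≠ v} 1_{K w}(g_w)) = 0` when some `g_w ∉ K w = U(H)(𝒪_w)`, `w ≠ v` — the `hF₀` case of the Euler brick.
[cite: Rogawski1990, §13.8 p. 218 L9–10] [cite: BorelJacquet1979, §4.1] -/
theorem mul_finprod_indicator_toLocal_eq_zero (v : HeightOneSpectrum (𝓞 ↥(maximalRealSubfield L)))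
    (K : ∀ w, Subgroup ((cmDatum L N H).Local w)) (hK : ∀ w, w ≠ v → K w = cmLocalIntegralLevel L N H w) (g : (cmDatum L N H).Adelic)
    (hg : ¬ ∀ w, w ≠ v → (cmDatum L N H).toLocal w g ∈ K w) (a b : ℂ) :
    a * (b * ∏ᶠ w : {w : HeightOneSpectrum (𝓞 ↥(maximalRealSubfield L)) // w ≠ v},
      ((K w.1 : Set ((cmDatum L N H).Local w.1))).indicator (fun _ => (1 : ℂ)) ((cmDatum L N H).toLocal w.1 g)) = 0 := by
  rw [finprod_indicator_toLocal_eq_zero v K hK g hg, mul_zero, mul_zero]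

end Summit.HodgeConjecture.HodgeConjecture.R90.S10

end
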